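import Summits.CriticalPhenomena.PercolationContinuityZ3.Theorems.PercNearOneGluingNoHeavyLowerTailSahiSlotPairConeThree
import Summits.CriticalPhenomena.PercolationContinuityZ3.Theorems.PercNearOneGluingNoHeavyLowerTailSahiSlotPairConeLiftCert

/-!
# STACKED FAMILIES over `[3]^3` bases: pinned certificates (hence good first slots) for `A × L₁ × ⋯ × L_k ⊆ [3]^{3+k}`, every up-set `A ⊆ [3]^3`,
# every `k`, `L_i ∈ {{2},{1,2}}`

Support file of the one-cut programme (crux `NoHeavyLowerTail`, stmt-CriticalPhenomena-4575; cell `prim-masterthm`, seat P3, gen 23;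
`run/shared/lean/prim/prim-masterthm/prim-masterthm-p3/HIERARCHY.md` §31, memo `FROM-prim-masterthm-p3-g23-FORMAT-LIFTS.md`).

`stackOn A ls` (`true ↦ × {2}`, `false ↦ × {1,2}`, outermost last) and **`pinnedGood_stackOn`** (every `n`: stacks over a pinned-good up-set are pinned-good, by the
format lifts `PinnedGood.liftTwo/liftTop` of `…SahiSlotPairConeLiftCert`); with `pinnedGood_three` (`…SahiSlotPairConeThree`): **`pinnedGood_stackOn_three`** —
every `A × L₁ × ⋯ × L_k` with `A ⊆ [3]^3` an up-set has a pinned (pivotal-pair) certificate in dimension `3 + k`, hence is a good first slot of the pattern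
functional (`sStarD_stackOn_three_nonneg`): an all-dimension family of good slots that are neither juntas of `≤ 3` coordinates (prim-sahi-p1 gen 11) nor
top-cube sets (p1 gen 19) nor orthants.  HONEST LABEL: new good slots in every dimension at the value level, via the format; no open cell changes status.
Pure, standard axioms. [this work]
-/

noncomputable section

namespace Summit.CriticalPhenomena.PercolationContinuityZ3.Theorems

open Finset Function
open Literature.Combinatorics.Sahi2008

namespace SahiSlot

open SahiGridPattern SahiGrid3

/-! ### Stacked families over an arbitrary base -/

variable {n : ℕ}

/-- `stackOn A ls`: the base up-set `A ⊆ [3]^n` followed by the levels `ls` (`true ↦ × {2}`, `false ↦ × {1,2}`), outermost last. [this work] -/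
def stackOn (A : Finset (Pd n)) : (ls : List Bool) → Finset (Pd (n + ls.length))
  | [] => A
  | true :: ls => liftTop (stackOn A ls)
  | false :: ls => liftTwo (stackOn A ls)

/-- Stacks over up-sets are up-sets. [this work] -/
theorem isUpperSet_stackOn {A : Finset (Pd n)} (hA : IsUpperSet (A : Set (Pd n))) :
    ∀ ls : List Bool, IsUpperSet ((stackOn A ls : Finset (Pd (n + ls.length))) : Set (Pd (n + ls.length)))
  | [] => by rw [show stackOn A [] = A from rfl]; exact hA
  | true :: ls => by
    rw [show stackOn A (true :: ls) = liftTop (stackOn A ls) from rfl]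
    exact isUpperSet_liftTop (isUpperSet_stackOn hA ls)
  | false :: ls => by
    rw [show stackOn A (false :: ls) = liftTwo (stackOn A ls) from rfl]
    exact isUpperSet_liftTwo (isUpperSet_stackOn hA ls)

/-- **Stacks over a pinned-good up-set are pinned-good** (every `n`, every level list). [this work] -/
theorem pinnedGood_stackOn {A : Finset (Pd n)} (hA : IsUpperSet (A : Set (Pd n))) (h : PinnedGood n A) :
    ∀ ls : List Bool, PinnedGood (n + ls.length) (stackOn A ls)
  | [] => by rw [show stackOn A [] = A from rfl]; exact h
  | true :: ls => by
    rw [show stackOn A (true :: ls) = liftTop (stackOn A ls) from rfl]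
    exact (pinnedGood_stackOn hA h ls).liftTop (isUpperSet_stackOn hA ls)
  | false :: ls => by
    rw [show stackOn A (false :: ls) = liftTwo (stackOn A ls) from rfl]
    exact (pinnedGood_stackOn hA h ls).liftTwo (isUpperSet_stackOn hA ls)

/-- **Every stacked set over an up-set of `[3]^3` has a pinned certificate** (dimension `3 + k`). [this work] -/
theorem pinnedGood_stackOn_three {A : Finset P3} (hA : IsUpperSet (A : Set P3)) (ls : List Bool) :
    PinnedGood (3 + ls.length) (stackOn A ls) :=
  pinnedGood_stackOn hA (pinnedGood_three hA) ls

/-- VALUE level: every such stacked set is a good first slot of the pattern functional. [this work] -/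
theorem sStarD_stackOn_three_nonneg {A : Finset P3} (hA : IsUpperSet (A : Set P3)) (ls : List Bool) (B C : Finset (Pd (3 + ls.length)))
    (hB : IsUpperSet (B : Set (Pd (3 + ls.length)))) (hC : IsUpperSet (C : Set (Pd (3 + ls.length)))) : 0 ≤ sStarD (stackOn A ls) B C :=
  (pinnedGood_stackOn_three hA ls).sStarD_nonneg B C hB hC

end SahiSlot

end Summit.CriticalPhenomena.PercolationContinuityZ3.Theorems
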